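import Mathlib
import Summits.ResolutionOfSingularities.ResolutionOfSingularities.Theorems.WeightedInvariantLocalWeightedDropWildMonicKangarooShear
import Summits.ResolutionOfSingularities.ResolutionOfSingularities.Theorems.WeightedInvariantLocalWeightedDropWildMonicKangarooBound

/-!
# `WeightedInvariant.LocalWeightedDrop`, line `hasse-ridge-face-selection`, S3ρ flag line (Uk-ρD3 `DropAxisKangaroo`):
# Perlega's Prop. 6.2.3 for tuples along a GENERAL SHEAR `y ↦ y + φ(x)` — the tame cases

Crux item stmt-ResolutionOfSingularities-8899 `LocalWeightedDrop` (route `ResolutionOfSingularities/WeightedInvariant`), engine of the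
door `HypersurfaceCentreConstruction` stmt-ResolutionOfSingularities-19897.  [OURS · L1 W4.3, chain w43, seat res-type-056 ((C8) D-d KANGAROO →
Uk-ρD3).  MODEL: S. Perlega, arXiv:2011.14443 Ch. 6 §2.1 Prop. 6.2.3 [cite: Perlega2020, Prop. 6.2.3 proof (∗) and the cases
`ỹ`-clean / `(1)_w`].  This file is `…WildMonicKangarooBoundCases` VERBATIM with the monomial twist `subst (twist x y n t)` replaced by
stub-1's general shear `subst (PurePowerFlag.shift φ)` (letters `0, 1`; `w 0 = 1`, `w 1 = n ≥ 1`; `∀ m < n, [x^m]φ = 0`, `[xⁿ]φ = c ≠ 0`) — the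
form in which res-L1-w43-stub-3's flag family presents a tangent flag (`flagTuple d A g h = shift d (A ∘ PurePowerFlag.shift h) g`); every proof
goes through the shear lemmas of `…WildMonicKangarooShear` instead of the twist lemmas.  Nothing here is a statement of H. Hironaka's
manuscript [claim: Hironaka2017, status: under-review]; OUR lemmas.]

* `pshift_dStar_shift_le_of_lt` — `d!·ord_w g > m ⇒ d_*(shift d (A ∘ shift φ) g) ≤ dInit w (newtonSet A)` (Prop. 6.2.3 (3));
* `pshift_dStar_shift_le_of_caseOne` — `d!·ord_w g = m`, `(1)_w`;
* `pshift_dStar_shift_le_dStar_of_yMin`, `pshift_dStar_shift_le_of_not_attains` — `d!·ord_w g = m`, the `ỹ`-valuation cases.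
The wild case and the assembled bound are in `…WildMonicKangarooShearBound`.  AI-written; gate-accepted means sorry-free, not refereed.
-/

set_option linter.dupNamespace false -- mandated namespace of this single-conjunct summit

noncomputable section

namespace Summit.ResolutionOfSingularities.ResolutionOfSingularities.Theorems

namespace WildMonic

open MvPowerSeries MonicDescent Polynomial

variable {k : Type} [Field k]

section Cases

variable {w : Fin 2 → ℕ} {n : ℕ} (hw0 : w 0 = 1) (hw1 : w 1 = n) (hn : 1 ≤ n) {φ : PowerSeries k} {c : k}
  (hφ : ∀ m, m < n → PowerSeries.coeff m φ = 0) (hc : PowerSeries.coeff n φ = c) (hc0 : c ≠ 0)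
  {d : ℕ} (A : Fin d → MvPowerSeries (Fin 2) k) (g : MvPowerSeries (Fin 2) k)

include hw0 hw1 hn hφ hc hc0 in
/-- CASE `d!·ord_w g > m`: every attaining slot keeps its initial form, so `d_*(B̃) ≤ dInit` (indeed `≤ d_*(B)`; Perlega: «if `f` is `ỹ`-clean …
`d_* = d₁ ≤ d`», Lemma 5.1.1 (2)). -/
theorem pshift_dStar_shift_le_of_lt {m : ℕ} (hm : wMin w A = m)
    (hG : wMin w A < (d.factorial : ℕ∞) * g.weightedOrder w) :
    dStar 1 w (shift d (fun j => subst (PurePowerFlag.shift φ) (A j)) g) ≤ (dInit w (newtonSet A) : ℕ) := by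
  have hm' : wMin w A ≠ ⊤ := by rw [hm]; exact ENat.coe_ne_top m
  set B : Fin d → MvPowerSeries (Fin 2) k := fun j => subst (PurePowerFlag.shift φ) (A j) with hBdef
  have hmB : wMin w B = wMin w A := wMin_pshift hw0 hw1 hn hφ hc A
  obtain ⟨j, hj⟩ := exists_slotWOrd_eq_wMin w A (pos_of_wMin_ne_top w A hm')
  have hjB : slotWOrd w B j = wMin w B := by rw [hBdef, slotWOrd_pshift hw0 hw1 hn hφ hc A j, hmB, hj]
  have hGB : wMin w B < (d.factorial : ℕ∞) * g.weightedOrder w := by rw [hmB]; exact hG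
  obtain ⟨hatt, hin⟩ := inW_shift_eq_of_kept w B g j hjB (by rw [hmB]; exact hm') hGB.le (fun j' _ => Or.inr hGB)
    (lt_of_lt_of_le hGB (le_slotWeight_mul_weightedOrder_top w g j))
  calc dStar 1 w (shift d B g) ≤ (slotWeight d j : ℕ∞) * (inW w (shift d B g j)).weightedOrder (Pi.single 1 1) :=
        dStar_le 1 w _ (attains_shift_of_slot w B g hGB.le hatt)
    _ = (slotWeight d j : ℕ∞) * (inW w (B j)).weightedOrder (Pi.single 1 1) := by rw [hin]
    _ ≤ (dInit w (newtonSet A) : ℕ) := mul_yOrd_inW_pshift_le_dInit hw0 hw1 hn hφ hc A hc0 hm hj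

variable (p : ℕ) [Fact p.Prime] [CharP k p]

include hw0 hw1 hn hφ hc hc0 in
/-- CASE `d!·ord_w g = m`, `(1)_w`: the LARGEST slot above `d − q` that attains `m` keeps its initial form (the slots above it do not attain, and its
top coefficient `C(d,i) g^{d−i}` vanishes by Lemma (c−q)); so `d_*(B̃) ≤ dInit` (Perlega, Prop. 6.2.3 proof, case `(1)_w`). -/
theorem pshift_dStar_shift_le_of_caseOne {m : ℕ} (hm : wMin w A = m) (heq : wMin w A = (d.factorial : ℕ∞) * g.weightedOrder w)
    (h1 : ∃ i : Fin d, d - qOf p d < (i : ℕ) ∧ slotWOrd w A i = wMin w A) :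
    dStar 1 w (shift d (fun j => subst (PurePowerFlag.shift φ) (A j)) g) ≤ (dInit w (newtonSet A) : ℕ) := by
  classical
  have hm' : wMin w A ≠ ⊤ := by rw [hm]; exact ENat.coe_ne_top m
  set B : Fin d → MvPowerSeries (Fin 2) k := fun j => subst (PurePowerFlag.shift φ) (A j) with hBdef
  have hmB : wMin w B = wMin w A := wMin_pshift hw0 hw1 hn hφ hc A
  have hslotB : ∀ j, slotWOrd w B j = slotWOrd w A j := fun j => by rw [hBdef, slotWOrd_pshift hw0 hw1 hn hφ hc A j]
  -- the largest attaining slot above `d − q`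
  set S : Finset (Fin d) := Finset.univ.filter (fun i : Fin d => d - qOf p d < (i : ℕ) ∧ slotWOrd w A i = wMin w A) with hS
  have hSne : S.Nonempty := by obtain ⟨i, hi⟩ := h1; exact ⟨i, Finset.mem_filter.mpr ⟨Finset.mem_univ i, hi⟩⟩
  obtain ⟨i, hiS, hmax⟩ := S.exists_max_image (fun i : Fin d => (i : ℕ)) hSne
  obtain ⟨hiq, hi⟩ := (Finset.mem_filter.mp hiS).2
  have hiB : slotWOrd w B i = wMin w B := by rw [hslotB, hmB, hi]
  have hlater : ∀ j : Fin d, (i : ℕ) < j → wMin w B < slotWOrd w B j ∨ wMin w B < (d.factorial : ℕ∞) * g.weightedOrder w := by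
    intro j hij
    left
    rw [hslotB, hmB]
    refine lt_of_le_of_ne (wMin_le_slotWOrd w A j) fun h => ?_
    have hjS : j ∈ S := Finset.mem_filter.mpr ⟨Finset.mem_univ j, by omega, h.symm⟩
    exact absurd (hmax j hjS) (not_le.mpr hij)
  have htop : wMin w B < (slotWeight d i : ℕ∞) *
      (((d.choose i : ℕ) : MvPowerSeries (Fin 2) k) * g ^ (d - (i : ℕ))).weightedOrder w := by
    rw [shift_top_eq_zero_of_gt (k := k) g p hiq, weightedOrder_zero, ENat.mul_top (by exact_mod_cast (slotWeight_pos i).ne'), hmB]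
    exact lt_top_iff_ne_top.mpr hm'
  obtain ⟨hatt, hin⟩ := inW_shift_eq_of_kept w B g i hiB (by rw [hmB]; exact hm') (by rw [hmB]; exact heq.le) hlater htop
  calc dStar 1 w (shift d B g) ≤ (slotWeight d i : ℕ∞) * (inW w (shift d B g i)).weightedOrder (Pi.single 1 1) :=
        dStar_le 1 w _ (attains_shift_of_slot w B g (by rw [hmB]; exact heq.le) hatt)
    _ = (slotWeight d i : ℕ∞) * (inW w (B i)).weightedOrder (Pi.single 1 1) := by rw [hin]
    _ ≤ (dInit w (newtonSet A) : ℕ) := mul_yOrd_inW_pshift_le_dInit hw0 hw1 hn hφ hc A hc0 hm hi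

include hw0 hw1 hn hφ hc hc0 in
/-- CASE `d!·ord_w g = m` and `d_*(B) < d!·ord_{(y)} in_w(g)`: the `ỹ`-minimal attaining slot keeps its `y`-order, so `d_*(B̃) ≤ d_*(B) ≤ dInit`
(valuation form of Lemma 5.1.1 (2) for `ỹ`; no cleanness needed). -/
theorem pshift_dStar_shift_le_dStar_of_yMin {m : ℕ} (hm : wMin w A = m) (heq : wMin w A = (d.factorial : ℕ∞) * g.weightedOrder w)
    (hgy : dStar 1 w (fun j => subst (PurePowerFlag.shift φ) (A j)) < (d.factorial : ℕ∞) * (inW w g).weightedOrder (Pi.single 1 1)) :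
    dStar 1 w (shift d (fun j => subst (PurePowerFlag.shift φ) (A j)) g) ≤ (dInit w (newtonSet A) : ℕ) := by
  have hm' : wMin w A ≠ ⊤ := by rw [hm]; exact ENat.coe_ne_top m
  set B : Fin d → MvPowerSeries (Fin 2) k := fun j => subst (PurePowerFlag.shift φ) (A j) with hBdef
  have hmB : wMin w B = wMin w A := wMin_pshift hw0 hw1 hn hφ hc A
  have hslotB : ∀ j, slotWOrd w B j = slotWOrd w A j := fun j => by rw [hBdef, slotWOrd_pshift hw0 hw1 hn hφ hc A j]
  have hmB' : wMin w B ≠ ⊤ := by rw [hmB]; exact hm'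
  obtain ⟨i, hi, hD⟩ := exists_attains_dStar_eq 1 w B hmB'
  obtain ⟨hatt, hyeq⟩ := slot_attains_and_yOrd_eq_of_yMin w B g 1 i hi hmB' (by rw [hmB]; exact heq)
    (fun j _ hj => by rw [← hD]; exact dStar_le 1 w B hj) (by rw [← hD]; exact hgy)
  have hiA : slotWOrd w A i = wMin w A := by rw [← hslotB, hi, hmB]
  calc dStar 1 w (shift d B g) ≤ (slotWeight d i : ℕ∞) * (inW w (shift d B g i)).weightedOrder (Pi.single 1 1) :=
        dStar_le 1 w _ (attains_shift_of_slot w B g (by rw [hmB]; exact heq.le) hatt)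
    _ = (slotWeight d i : ℕ∞) * (inW w (B i)).weightedOrder (Pi.single 1 1) := by rw [hyeq]
    _ ≤ (dInit w (newtonSet A) : ℕ) := mul_yOrd_inW_pshift_le_dInit hw0 hw1 hn hφ hc A hc0 hm hiA

include hw0 hw1 hn hφ hc hc0 in
/-- CASE `d!·ord_w g = m`, no slot above `d − q` attains, the slot `d − q` does NOT attain (`(2)_w`), and `d!·ord_{(y)} in_w(g) ≤ d_*(B)`: the slot
`d − q` of `B̃` carries `C(d,q)·in_w(g)^q` (Lemma 5.1.2 (ii)) and gives `d_*(B̃) ≤ d!·ord_{(y)} in_w(g) ≤ d_*(B) ≤ dInit`. -/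
theorem pshift_dStar_shift_le_of_not_attains {m : ℕ} (hm : wMin w A = m) (heq : wMin w A = (d.factorial : ℕ∞) * g.weightedOrder w)
    (hno : ∀ j : Fin d, d - qOf p d < (j : ℕ) → wMin w A < slotWOrd w A j)
    {i : Fin d} (hiq : (i : ℕ) = d - qOf p d) (h2 : wMin w A < slotWOrd w A i)
    (hgy : (d.factorial : ℕ∞) * (inW w g).weightedOrder (Pi.single 1 1) ≤ dStar 1 w (fun j => subst (PurePowerFlag.shift φ) (A j))) :
    dStar 1 w (shift d (fun j => subst (PurePowerFlag.shift φ) (A j)) g) ≤ (dInit w (newtonSet A) : ℕ) := by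
  have hm' : wMin w A ≠ ⊤ := by rw [hm]; exact ENat.coe_ne_top m
  have hd : 0 < d := Fin.pos i
  set B : Fin d → MvPowerSeries (Fin 2) k := fun j => subst (PurePowerFlag.shift φ) (A j) with hBdef
  have hmB : wMin w B = wMin w A := wMin_pshift hw0 hw1 hn hφ hc A
  have hslotB : ∀ j, slotWOrd w B j = slotWOrd w A j := fun j => by rw [hBdef, slotWOrd_pshift hw0 hw1 hn hφ hc A j]
  have hmB' : wMin w B ≠ ⊤ := by rw [hmB]; exact hm'
  have heqB : wMin w B = (d.factorial : ℕ∞) * g.weightedOrder w := by rw [hmB]; exact heq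
  have hg : g ≠ 0 := ne_zero_of_factorial_mul_eq w B g hmB' heqB
  -- `V = q · ord_w g` with `s_{d−q} · V = m`
  have hgfin : g.weightedOrder w ≠ ⊤ := (weightedOrder_eq_top_iff w).not.mpr hg
  set γ := (g.weightedOrder w).toNat with hγ
  have hγeq : g.weightedOrder w = γ := (ENat.coe_toNat hgfin).symm
  have hq : d - (i : ℕ) = qOf p d := by have := Nat.le_of_dvd hd (qOf_dvd p d); omega
  have hV : (slotWeight d i : ℕ∞) * ((qOf p d * γ : ℕ) : ℕ∞) = wMin w B := by
    rw [heqB, hγeq, Nat.cast_mul, ← mul_assoc, ← Nat.cast_mul, ← hq, slotWeight_mul_sub]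
  -- the component of `B_{d−q}` vanishes (the slot does not attain)
  have hcomp0 : weightedHomogeneousComponent w (qOf p d * γ) (B i) = 0 := by
    apply component_eq_zero_of_lt w
    refine lt_of_slotWeight_mul_lt i ?_
    rw [hV]
    show wMin w B < slotWOrd w B i
    rw [hslotB, hmB]; exact h2
  have hcne : ((d.choose i : ℕ) : k) ≠ 0 := by
    rw [← Nat.choose_symm i.2.le, hq]; exact natCast_choose_qOf_ne_zero (k := k) p hd
  have hH : weightedHomogeneousComponent w (qOf p d * γ) (B i) +
      MvPowerSeries.C ((d.choose i : ℕ) : k) * (inW w g) ^ (d - (i : ℕ)) ≠ 0 := by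
    rw [hcomp0, zero_add]
    exact mul_ne_zero (fun h => hcne (by simpa using congrArg MvPowerSeries.constantCoeff h)) (pow_ne_zero _ (inW_ne_zero w hg))
  obtain ⟨hatt, hin⟩ := inW_shift_slot_sub_qOf w B g p hiq hmB' heqB (fun j hj => by rw [hslotB, hmB]; exact hno j hj) hV hH
  rw [hcomp0, zero_add] at hin
  calc dStar 1 w (shift d B g) ≤ (slotWeight d i : ℕ∞) * (inW w (shift d B g i)).weightedOrder (Pi.single 1 1) :=
        dStar_le 1 w _ (attains_shift_of_slot w B g heqB.le hatt)
    _ = (d.factorial : ℕ∞) * (inW w g).weightedOrder (Pi.single 1 1) := by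
        rw [hin, weightedOrder_C_mul_of_ne_zero _ hcne, weightedOrder_pow_eq, ← mul_assoc, ← Nat.cast_mul, hq, ← hq, slotWeight_mul_sub]
    _ ≤ dStar 1 w B := hgy
    _ ≤ (dInit w (newtonSet A) : ℕ) := dStar_pshift_le_dInit hw0 hw1 hn hφ hc A hc0 hm

end Cases

end WildMonic

end Summit.ResolutionOfSingularities.ResolutionOfSingularities.Theorems

end
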